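import Summits.ABC.IUTFork.Repair.ModelGrowingColumn
import Summits.ABC.IUTFork.Repair.CandExplicit6
import Summits.ABC.IUTFork.Repair.CandExplicit8
import HarnessLib

/-!
# IUT REPAIR branch (rung LADDER-ABC:A2.RP ⊆ A2.B) — the GROWING-COLUMN bed as an ENGINE: one-line SAT⊖[KummerB] cells and the
# «does H ⟹ S use Thm. 3.11 (ii)(b)?» test, for ANY candidate of the branch's arity

Proof-only record file (no definition, no `Prop` fact) of the abc-iut cell's REPAIR branch (seat abc-iut-rp-x2; lead abc-iut-rp-plan,
`HOME/plan/repair/REPAIR-SPEC.md` v0.4 PROFILE). TAKES NO SIDE; nothing here asserts abc or [IUTchIII] Cor. 3.12 proved or refuted; candidates are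
hypotheses; typed ≠ proved. Imported BY NAME: this seat's `Repair.ModelGrowingColumn` (p431535: `growFull` / `growSetting` / `qOne` — the toy in
which the Frobenius-like Θ-image GROWS along the column as [EssLgc] (CnfInd3)/(logORInd) describe; there Thm. 3.11 (i), (iii), (ii)(a), (ii)(c),
(Ind3)-as-typed hold, (ii)(b) `KummerB` FAILS, the three pins / bridge hypotheses / `|log(q)| > 0` / Step (x) / honest scaling hold, Reading R3,
the Licence and the Statement hold, and the residual S FAILS). [claim: Mochizuki2012, status: disputed]

USAGE (like abc-iut-w5-d230's `satNatural_of_holds_at_natSetting` and abc-iut-rp-cx's `insufficient_of_holds_at_pinned`): for a candidate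
`H : ∀ {T} (S : LatticeSituation T) (P : Cor312.Setting S.toSituation) ρ qK, Prop`, prove ONE fact `h : H (growFull 2).toLatticeSituation
(growSetting 2) (ballOfMonoid 2) (qOne 2)` (usually `by` a short computation with `grow_qRegion` / `grow_thetaRegion3` / `grow_possibleImages`) and get
* `satMinusKummerB_of_holds_at_grow H h` — the ∃-packaged SAT⊖[KummerB] cell (interface minus (ii)(b), pins, `H`, R3, Statement, `¬ S`);
* `needs_kummerB_of_holds_at_grow H h` — NO derivation `H → S` exists from the typed interface WITHOUT Thm. 3.11 (ii)(b): the schema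
  «PartI → PartIII → KummerA → KummerC → Ind3 → BridgeHyps → AbsLogQPos → PinnedRegions3 → H → S» is refuted at the bed. So a row whose T-a
  proof cites `KummerB` (directly or through `FullSituation.Statement`) cites it ESSENTIALLY iff its `H` holds at the bed.
Nothing asserted; no side taken; typed ≠ proved.
-/

noncomputable section

namespace Summit.ABC.IUTFork.Repair.ModelGrowingColumn

open Thm311 Cor312 Cor312Vol Literature.IUT.LogThetaLattice
open Cor312Vol.NaiveWitness Cor312Vol.PinnedWitness Cor312Vol.GluedMonoids.Naive Cor312.Checks Cor312.IdentifiedNonVacuity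

variable (H : ∀ {T : ThetaIndex} (S : LatticeSituation T) (P : Cor312.Setting S.toSituation),
    ((∀ v : T.V, v ∈ T.Vbad → Set (S.L.StarPacket v)) → ∀ (j : T.Label) (vQ : T.VQ), Set (S.L.Packet j vQ)) →
    (∀ v : T.V, v ∈ T.Vbad → Set (S.L.StarPacket v)) → Prop)

/-- **`satMinusKummerB_of_holds_at_grow` — the SAT⊖[KummerB] cell, packaged**: a candidate that HOLDS at the growing-column bed is jointly
satisfiable with Thm. 3.11 (i) ∧ (iii) ∧ (ii)(a) ∧ (ii)(c) ∧ (Ind3)-as-typed, `BridgeHyps`, `|log(q)| > 0`, the three pins, print's Reading R3 and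
the typed Statement — at a point where Thm. 3.11 (ii)(b) `KummerB` and the residual S both FAIL. [folklore] -/
theorem satMinusKummerB_of_holds_at_grow
    (h : H (growFull 2).toLatticeSituation (growSetting 2) (ballOfMonoid 2) (qOne 2)) :
    ∃ (T : ThetaIndex) (F : FullSituation T) (P : Cor312.Setting F.toLatticeSituation.toSituation)
      (ρ : (∀ v : T.V, v ∈ T.Vbad → Set (F.L.StarPacket v)) → ∀ (j : T.Label) (vQ : T.VQ), Set (F.L.Packet j vQ))
      (qK : ∀ v : T.V, v ∈ T.Vbad → Set (F.L.StarPacket v)),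
      F.PartI ∧ F.PartIII ∧ (F.toLatticeSituation.col P.n).KummerA (F.toLatticeSituation.D P.n) ∧
        (F.toLatticeSituation.col P.n).KummerC (F.toLatticeSituation.D P.n) ∧
        (F.toLatticeSituation.col P.n).Ind3 (F.toLatticeSituation.D P.n) ∧
        ¬ (F.toLatticeSituation.col P.n).KummerB (F.toLatticeSituation.D P.n) ∧
        BridgeHyps P ∧ P.AbsLogQPos ∧ PinnedRegions3 F.toLatticeSituation P ρ qK ∧ H F.toLatticeSituation P ρ qK ∧
        (∀ (j : T.Label) (vQ : T.VQ), P.qRegion j vQ ∈ P.possibleImages j vQ) ∧ P.Statement ∧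
        ¬ PilotKummerIndRelated F.toLatticeSituation P ρ qK := by
  haveI : Fact (Nat.Prime 2) := ⟨Nat.prime_two⟩
  exact ⟨toyIndex, growFull 2, growSetting 2, ballOfMonoid 2, qOne 2, grow_partI 2, grow_partIII 2, grow_kummerA 2 _, grow_kummerC 2 _,
    grow_ind3 2 _, grow_not_kummerB 2 _, grow_bridgeHyps 2, grow_absLogQPos 2, grow_pinnedRegions3 2, h, grow_reading3 2,
    (grow_statement 2).1, grow_not_S 2⟩

/-- **`needs_kummerB_of_holds_at_grow` — the (ii)(b)-ESSENTIALITY TEST**: if a candidate HOLDS at the growing-column bed, then the derivation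
schema «typed Thm. 3.11 WITHOUT (ii)(b) + bridge hypotheses + `|log(q)| > 0` + three pins + `H` ⟹ S» is FALSE — any kernel proof of `H → S`
must use `KummerB` (or something failing at the bed). [folklore] -/
theorem needs_kummerB_of_holds_at_grow
    (h : H (growFull 2).toLatticeSituation (growSetting 2) (ballOfMonoid 2) (qOne 2)) :
    ¬ ∀ (T : ThetaIndex) (F : FullSituation T) (P : Cor312.Setting F.toLatticeSituation.toSituation)
        (ρ : (∀ v : T.V, v ∈ T.Vbad → Set (F.L.StarPacket v)) → ∀ (j : T.Label) (vQ : T.VQ), Set (F.L.Packet j vQ))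
        (qK : ∀ v : T.V, v ∈ T.Vbad → Set (F.L.StarPacket v)),
        F.PartI → F.PartIII → (F.toLatticeSituation.col P.n).KummerA (F.toLatticeSituation.D P.n) →
          (F.toLatticeSituation.col P.n).KummerC (F.toLatticeSituation.D P.n) →
          (F.toLatticeSituation.col P.n).Ind3 (F.toLatticeSituation.D P.n) →
          BridgeHyps P → P.AbsLogQPos → PinnedRegions3 F.toLatticeSituation P ρ qK → H F.toLatticeSituation P ρ qK →
          PilotKummerIndRelated F.toLatticeSituation P ρ qK := by
  intro hall
  haveI : Fact (Nat.Prime 2) := ⟨Nat.prime_two⟩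
  exact grow_not_S 2 (hall toyIndex (growFull 2) (growSetting 2) (ballOfMonoid 2) (qOne 2) (grow_partI 2) (grow_partIII 2)
    (grow_kummerA 2 _) (grow_kummerC 2 _) (grow_ind3 2 _) (grow_bridgeHyps 2) (grow_absLogQPos 2) (grow_pinnedRegions3 2) h)

/-- The same test at the READING-R3 / hull level is VACUOUS in the other direction: a candidate holding at the bed is consistent with R3, the
Licence and the Statement without (ii)(b) (they hold there). [folklore] -/
theorem consistent_with_statement_without_kummerB_of_holds_at_grow
    (h : H (growFull 2).toLatticeSituation (growSetting 2) (ballOfMonoid 2) (qOne 2)) :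
    ∃ (T : ThetaIndex) (F : FullSituation T) (P : Cor312.Setting F.toLatticeSituation.toSituation)
      (ρ : (∀ v : T.V, v ∈ T.Vbad → Set (F.L.StarPacket v)) → ∀ (j : T.Label) (vQ : T.VQ), Set (F.L.Packet j vQ))
      (qK : ∀ v : T.V, v ∈ T.Vbad → Set (F.L.StarPacket v)),
      ¬ (F.toLatticeSituation.col P.n).KummerB (F.toLatticeSituation.D P.n) ∧ PinnedRegions3 F.toLatticeSituation P ρ qK ∧
        H F.toLatticeSituation P ρ qK ∧ Thm311ToCor312.Licence P ∧ P.Statement :=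
  by
  haveI : Fact (Nat.Prime 2) := ⟨Nat.prime_two⟩
  exact ⟨toyIndex, growFull 2, growSetting 2, ballOfMonoid 2, qOne 2, grow_not_kummerB 2 _, grow_pinnedRegions3 2, h, grow_licence 2,
    (grow_statement 2).1⟩

/-! ## Instances for this seat's rows (the pattern other seats copy) -/

/-- RP-X04a at the bed, through the engine: `CandExplicit4.H ⟹ S` NEEDS (ii)(b). (Indeed `CandExplicit4.S_of_H'`/`H_iff_subset_of_pinned` cite
`KummerB`.) [folklore] -/
theorem candExplicit4_H_needs_kummerB :
    ¬ ∀ (T : ThetaIndex) (F : FullSituation T) (P : Cor312.Setting F.toLatticeSituation.toSituation)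
        (ρ : (∀ v : T.V, v ∈ T.Vbad → Set (F.L.StarPacket v)) → ∀ (j : T.Label) (vQ : T.VQ), Set (F.L.Packet j vQ))
        (qK : ∀ v : T.V, v ∈ T.Vbad → Set (F.L.StarPacket v)),
        F.PartI → F.PartIII → (F.toLatticeSituation.col P.n).KummerA (F.toLatticeSituation.D P.n) →
          (F.toLatticeSituation.col P.n).KummerC (F.toLatticeSituation.D P.n) →
          (F.toLatticeSituation.col P.n).Ind3 (F.toLatticeSituation.D P.n) →
          BridgeHyps P → P.AbsLogQPos → PinnedRegions3 F.toLatticeSituation P ρ qK → CandExplicit4.H F.toLatticeSituation P →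
          PilotKummerIndRelated F.toLatticeSituation P ρ qK :=
  needs_kummerB_of_holds_at_grow (fun S P _ _ => CandExplicit4.H S P) (grow_H 2)

/-- RP-X04b likewise: `CandExplicit4.H' ⟹ S` (this seat's `S_of_H'`, which cites `KummerB`) NEEDS (ii)(b). [folklore] -/
theorem candExplicit4_H'_needs_kummerB :
    ¬ ∀ (T : ThetaIndex) (F : FullSituation T) (P : Cor312.Setting F.toLatticeSituation.toSituation)
        (ρ : (∀ v : T.V, v ∈ T.Vbad → Set (F.L.StarPacket v)) → ∀ (j : T.Label) (vQ : T.VQ), Set (F.L.Packet j vQ))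
        (qK : ∀ v : T.V, v ∈ T.Vbad → Set (F.L.StarPacket v)),
        F.PartI → F.PartIII → (F.toLatticeSituation.col P.n).KummerA (F.toLatticeSituation.D P.n) →
          (F.toLatticeSituation.col P.n).KummerC (F.toLatticeSituation.D P.n) →
          (F.toLatticeSituation.col P.n).Ind3 (F.toLatticeSituation.D P.n) →
          BridgeHyps P → P.AbsLogQPos → PinnedRegions3 F.toLatticeSituation P ρ qK → CandExplicit4.H' F.toLatticeSituation P →
          PilotKummerIndRelated F.toLatticeSituation P ρ qK :=
  needs_kummerB_of_holds_at_grow (fun S P _ _ => CandExplicit4.H' S P) (grow_H' 2)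

/-- RP-X02 / RP-X06 (level S) at the bed: both HOLD (the Statement holds there, attained). For RP-X06 this is [EssLgc] (Cohab) read in
full — p. 99 l. 34–40: «(Cohab) One may think of (ΘGl) as a statement concerning the "cohabitation", or "coexistence", of the q-pilot and
Θ-pilot — relative to the gluing of abstract F⊩▶×μ-prime-strips constituted by the Θ-link — within the common container obtained by applying
the multiradial representation of the Θ-pilot, forming the holomorphic hull [relative to the holomorphic structure [i.e., (Θ±ellNF-)Hodge
theater] that gave rise to the q-pilot under consideration], and finally taking log-volumes.» (the bracket «relative to the holomorphic
structure … that gave rise to the q-pilot» — print's nearest sentence to the FRAME locus, abc-iut-rp-ref-3 TD-RP-X06 — was elided in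
`CandExplicit6`'s docstring and is quoted here in full). [folklore] -/
theorem candExplicit26_H_at_grow :
    CandExplicit2.H (growFull 2).toLatticeSituation (growSetting 2) ∧ CandExplicit6.H (growFull 2).toLatticeSituation (growSetting 2) := by
  haveI : Fact (Nat.Prime 2) := ⟨Nat.prime_two⟩
  exact ⟨CandExplicit2.H_of_statement _ _ (grow_absLogQPos 2) (grow_statement 2).1, CandExplicit6.H_of_statement _ _ (grow_statement 2).1⟩

/-- RP-X09 at the bed: the bounded-discrepancy clause `CandExplicit8.H 0` HOLDS (Step (x) holds for the coric data) — together with `¬ S`; the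
barrier `not_S_of_H_of_deep` is not contradicted: its q-region is `B_1` at every label, its honest-scaling premise reads the CORIC datum's
region `B_{j²}` — consistent. [folklore] -/
theorem candExplicit8_H_zero_at_grow : CandExplicit8.H (growFull 2).toLatticeSituation (growSetting 2) 0 := by
  haveI : Fact (Nat.Prime 2) := ⟨Nat.prime_two⟩
  exact CandExplicit8.H_zero_of_stepX _ _ (grow_honesty 2).1 (grow_honesty 2).2.1

end Summit.ABC.IUTFork.Repair.ModelGrowingColumn

end
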